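import Summits.QuantumFields.BalabanUV.Beta.GAN24.UndressedResponseUnits

/-!
# `BalabanUV.Beta.GAN24.DressedLegUnits` — binder row G-an2-4 / (CONV-C), the row OWNER's CONTACT-TERM ROUTE to the LEFT END's S-slot letters
# (`gan24-p1` gen 17, `CT-ROUTE-v1.md` §3; INTERFACE REQUEST G-an2-4 (B), `HOME/INBOX.md` l.6516): LEMMA **CT-2 — THE ACCUMULATED INTER-BLOCK GAUGE
# `Ψ` OF THE DRESSED COMPOSITE LEGS IS BOUNDED IN UNITS**, PER LEVEL AND SUMMED, UNIFORMLY IN THE PAIR OF LEVELS (`d = 3`, `Lc ≥ 2`); the owner's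
# display `T^E = T^B + dz λ` with **`|λ| ≤ K·(Lc^{4(k+1)})⁻¹·sup|b|`** («`|λ| ≤ C·N·σ_f`»), and **THE DRESSED COMPOSITE LEGS `T^E_{m→m+k+1}` BOUNDED IN UNITS**

NOT IN PRINT; OUR BOOKKEEPING (G-an2-4 formalisation swarm, leaf prover `b2b-balaban-gan24-formalise-leaf-01`, gen 57; file B of the CT-2 triple
A `UndressedResponseUnits` → B → C `DressedLegEnvelope`; the refuter's price `PRICING-GAN24.md` v3.8 §1: «CT-2 S–M (per level; bookkeeping over two
tree inputs + `Psi_apply`)», residual (r-ii) «CT-2 must be stated PER LEVEL»).  HONEST FRAMING (cell contract, verbatim): «discharging `BetaPertH` makes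
Bałaban's UV stability UNCONDITIONAL — a real constructive-QFT result; it is NOT the continuum limit and NOT the Clay problem.»  HONEST DEPENDENCY
(verbatim): «continuum YM on T⁴ ⇐ BetaPertH ∧ nine spine estimates (0/9 proved); BetaPertH ⇐ (D1) ∧ (D4) ∧ CAP+tail; G-an2-4 gates asym, D1 and NE2/3/4.»

## The two tree inputs (BY NAME, nothing restated)
* leaf-03-g41's DECOMPOSITION `RespStepBmDecompPsi.legAct_legChain_respStepBm`: `legAct (legChain D m k) b = Π^ρ_bm (legAct (respStep (Lc^m)
  (Lc^(m+k+1))) b) + dz (Psi ρ Lc m k b)`, with the accumulated gauge DISPLAYED (`Psi_apply`):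
  `Psi ρ Lc m k b x = − Σ_{i<k} ((Lc^{(d+1)(i+1)})⁻¹) · bmGaugeAt ρ (legAct (respStep (Lc^(m+i+1)) (Lc^(m+k+1))) b) Lc (blk (Lc^(i+1)) x)`;
* file A's `UndressedResponseUnits.exists_abs_legAct_respStep_le` (leaf-12-g20's one-shot letter `RespStepDecay.exists_respStep_decay_and_grad` summed
  against bounded data): `|legAct (respStep (Lc^m) (Lc^(m+k+1))) b κ u| ≤ K·(Lc^{5(k+1)})⁻¹·sup|b|` for ALL `m k`.

## Contents ([folklore] triangle inequalities; 0 `def`, 0 `def … : Prop`, 0 cited facts, 0 sorry)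
* §1 (generic `d`) SUP FORMS: **`abs_treeGaugeAt_le_of_sup`** ∕ **`abs_bmGaugeAt_le_of_sup`** (`|bmGaugeAt ρ A N p| ≤ 2(d+1)N·sup|A|`, the sup twin of
  leaf-03's `abs_bmGaugeAt_le_blockMass`), `abs_dz_le_two_mul`, **`abs_axProjBmAt_le_of_sup`** (`|Π^ρ_bm A| ≤ (1 + 4(d+1)N)·sup|A|`),
  `geom_sum_le_of_two_le`; **`legAct_legChain_eq_add_dz`** — the owner's display `T^E = T^B + dz λ`, `λ := Psi ρ Lc m k b − bmGaugeAt ρ (T^B b) Lc`.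
* §2 (`d = 3`, `[NeZero Lc]`; `2 ≤ Lc` where the geometric series is summed) THE UNIFORM LAWS, constants OUTSIDE every `∀`:
  `exists_abs_bmGaugeAt_respStep_le` (one-level rooted gauge of `T^B`: `≤ K·Lc·(Lc^{5(j+1)})⁻¹·sup|b|`), **`exists_abs_PsiTerm_le`** (CT-2 PER LEVEL, the
  refuter's (r-ii): the `i`-th term of `Ψ_{m,k}`, source `(m+i+1)+j+1`, `≤ K·(Lc^{4(i+1)})⁻¹·(Lc·(Lc^{5(j+1)})⁻¹)·sup|b|` — transport factor × gauge
  amplitude), **`exists_abs_Psi_le`** (CT-2 SUMMED: `|Psi ρ Lc m k b x| ≤ K·(Lc^{4(k+1)})⁻¹·sup|b|`, ALL `m k` — the terms grow geometrically towards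
  the source, ratio `Lc`, the COARSEST intermediate level dominates, `Σ_{i<k} Lc^i ≤ 2·Lc^k∕Lc`), `exists_abs_dz_Psi_le`, **`exists_abs_gauge_le`**
  (THE OWNER's «`|λ| ≤ C·N·σ_f`»: `N = Lc^(k+1)`, `σ_f ~ (Lc^{5(k+1)})⁻¹·sup|b|` the size of `T^B`), **`exists_abs_legAct_legChain_le`** (THE DRESSED
  COMPOSITE LEGS `T^E` IN UNITS: `≤ K·(Lc^{4(k+1)})⁻¹·sup|b|`, ALL `m k`, summable bounded data — one power of `L` above `T^B`: the inter-block gauge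
  sawtooth, the owner's numerics «`max|dλ|∕max|T^B| × Lc` per level»).
HONEST: `U = 1`, `d = 3`, in-block roots, constants existential (functions of `Lc` and of the (N1) letter's `κ₀, C`); zeroth order for the DRESSED
legs (their unit gradient is dominated by the face jumps of the gauge sawtooth — no `1∕L` gain; CT-3 moves the derivative onto the UNDRESSED legs,
whose gradient letter file A supplies); discharges NO binder of (CONV-C) (`hSrow` ∕ `hSdev` untouched), 0 wall binders; NOT CT-3 ∕ CT-4; NEVER
«G-an2-4 closed»; NOT D1, NOT BetaPertH, NOT continuum, NOT Clay.
-/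

noncomputable section

open Finset
open scoped BigOperators
open Literature.MathematicalPhysics.QuantumFieldTheory
open Literature.MathematicalPhysics.QuantumFieldTheory.LatticeForm (quo)
open Literature.MathematicalPhysics.QuantumFieldTheory.Balaban1983to89
open Literature.MathematicalPhysics.QuantumFieldTheory.Balaban1983to89.Beta
open B12Sec2to5 (l1)
open B4ContourShift (supNorm)
open ExpKernelCalculus (Zl Zl_nonneg l1_sub_symm)
open AffineAveraging (Form0 Form1 Site box toSite unitVec dz)
open AveragingContours (blk axial grad_eq_dz)
open AveragingContoursRooted (treeGaugeAt)
open BalabanCompositeJets (respStep)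
open Summit.QuantumFields.BalabanUV.Beta.AxialProjectorBlockMean (blockMeanAt bmGaugeAt axProjBmAt)
open Summit.QuantumFields.BalabanUV.Beta.AxialDressingRooted (mem_axial_hull axial_length_le_of_root)
open Summit.QuantumFields.BalabanUV.Beta.GAN24.Push4Iter (LegFam legChain)
open Summit.QuantumFields.BalabanUV.Beta.GAN24.RespStepBmDecompLegs (legAct legAct_apply)
open Summit.QuantumFields.BalabanUV.Beta.GAN24.RespStepBmDecompExact (abs_list_sum_le abs_blockMeanAt_le respStepBmSeq)
open Summit.QuantumFields.BalabanUV.Beta.GAN24.RespStepBmDecompPsi (Psi Psi_apply legAct_legChain_respStepBm)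
open Summit.QuantumFields.BalabanUV.Beta.GAN24.UndressedResponseUnits (exists_abs_legAct_respStep_le)

namespace Summit.QuantumFields.BalabanUV.Beta.GAN24.DressedLegUnits

variable {d : ℕ}

/-! ## §1 Sup forms (generic dimension) -/

/-- [folklore] **THE ROOTED TREE INTEGRAL, SUP FORM** (in-block root): `|λ^ρ_A(p)| ≤ (d+1)·N·S` whenever `|A κ z| ≤ S` — at most `(d+1)·N`
letters `±A κ z′` (an2's `axial_length_le_of_root` ∕ `mem_axial_hull`; the sup twin of leaf-03's `abs_treeGaugeAt_le_blockMass`). -/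
theorem abs_treeGaugeAt_le_of_sup {N : ℕ} (hN : 1 ≤ N) {rr : Fin (d + 1) → ℕ} (hrr : rr ∈ box (d + 1) N)
    {A : Form1 (d + 1) ℝ} {S : ℝ} (hA : ∀ κ z, |A κ z| ≤ S) (p : Site (d + 1)) :
    |treeGaugeAt (toSite rr) A N p| ≤ (((d : ℝ) + 1) * N) * S := by
  unfold treeGaugeAt
  have hS : 0 ≤ S := (abs_nonneg _).trans (hA 0 0)
  have hletter : ∀ a ∈ axial A ((N : ℤ) • blk N p + toSite rr) p, |a| ≤ S := by
    intro a ha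
    obtain ⟨κ, z', e, -, -⟩ := mem_axial_hull ha
    rcases e with e | e
    · rw [e]; exact hA κ z'
    · rw [e, abs_neg]; exact hA κ z'
  have hlen : ((axial A ((N : ℤ) • blk N p + toSite rr) p).length : ℝ) ≤ ((d : ℝ) + 1) * N := by
    have h := axial_length_le_of_root hN hrr A p
    exact_mod_cast h
  exact (abs_list_sum_le hletter).trans (mul_le_mul_of_nonneg_right hlen hS)

/-- [folklore] **THE BLOCK-MEAN-NORMALISED ROOTED GAUGE, SUP FORM**: `|bmGaugeAt ρ A N p| ≤ 2·(d+1)·N·S` whenever `|A κ z| ≤ S`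
(the tree integral and its block mean, leaf-03's `abs_blockMeanAt_le`). -/
theorem abs_bmGaugeAt_le_of_sup {N : ℕ} (hN : 1 ≤ N) {rr : Fin (d + 1) → ℕ} (hrr : rr ∈ box (d + 1) N)
    {A : Form1 (d + 1) ℝ} {S : ℝ} (hA : ∀ κ z, |A κ z| ≤ S) (p : Site (d + 1)) :
    |bmGaugeAt (toSite rr) A N p| ≤ 2 * ((((d : ℝ) + 1) * N) * S) := by
  unfold bmGaugeAt
  rw [Pi.sub_apply]
  have h1 := abs_treeGaugeAt_le_of_sup hN hrr hA p
  have h2 : |blockMeanAt N (treeGaugeAt (toSite rr) A N) p| ≤ (((d : ℝ) + 1) * N) * S :=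
    abs_blockMeanAt_le hN _ fun b _ => abs_treeGaugeAt_le_of_sup hN hrr hA _
  calc |treeGaugeAt (toSite rr) A N p - blockMeanAt N (treeGaugeAt (toSite rr) A N) p|
      ≤ |treeGaugeAt (toSite rr) A N p| + |blockMeanAt N (treeGaugeAt (toSite rr) A N) p| := abs_sub _ _
    _ ≤ _ := by linarith

/-- [folklore] A gradient of a bounded 0-form is at most twice the bound. -/
theorem abs_dz_le_two_mul {f : Form0 (d + 1) ℝ} {S : ℝ} (hf : ∀ x, |f x| ≤ S) (κ : Fin (d + 1)) (x : Site (d + 1)) :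
    |dz f κ x| ≤ 2 * S := by
  simp only [dz]
  exact (abs_sub _ _).trans (by linarith [hf (x + unitVec κ), hf x])

/-- [folklore] **THE BLOCK-MEAN-NORMALISED ROOTED AXIAL PROJECTOR, SUP FORM**: `|(Π^ρ_bm A) κ x| ≤ (1 + 4·(d+1)·N)·S` whenever `|A κ z| ≤ S`. -/
theorem abs_axProjBmAt_le_of_sup {N : ℕ} (hN : 1 ≤ N) {rr : Fin (d + 1) → ℕ} (hrr : rr ∈ box (d + 1) N)
    {A : Form1 (d + 1) ℝ} {S : ℝ} (hA : ∀ κ z, |A κ z| ≤ S) (κ : Fin (d + 1)) (x : Site (d + 1)) :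
    |axProjBmAt (toSite rr) N A κ x| ≤ (1 + 4 * (((d : ℝ) + 1) * N)) * S := by
  unfold axProjBmAt
  rw [Pi.sub_apply, Pi.sub_apply, grad_eq_dz]
  have h1 := hA κ x
  have h2 := abs_dz_le_two_mul (fun p => abs_bmGaugeAt_le_of_sup hN hrr hA p) κ x
  calc |A κ x - dz (bmGaugeAt (toSite rr) A N) κ x| ≤ |A κ x| + |dz (bmGaugeAt (toSite rr) A N) κ x| := abs_sub _ _
    _ ≤ S + 2 * (2 * ((((d : ℝ) + 1) * N) * S)) := add_le_add h1 h2
    _ = _ := by ring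

/-- [folklore] The geometric series with ratio `x ≥ 2`: `Σ_{i<k} x^i ≤ 2·x^k∕x`. -/
theorem geom_sum_le_of_two_le {x : ℝ} (hx : 2 ≤ x) (k : ℕ) : ∑ i ∈ Finset.range k, x ^ i ≤ 2 * x ^ k / x := by
  have hx1 : x ≠ 1 := by
    intro h; rw [h] at hx; norm_num at hx
  rw [geom_sum_eq hx1]
  have hx0 : 0 < x := by linarith
  have hxm : 0 < x - 1 := by linarith
  rw [div_le_div_iff₀ hxm hx0]
  have hk : 0 ≤ x ^ k := (pow_pos hx0 k).le
  nlinarith [mul_nonneg hk (show (0 : ℝ) ≤ x - 2 by linarith)]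

/-- [folklore] **THE OWNER's DISPLAY `T^E = T^B + dz λ`** (generic `d`, in-block root, summable datum): the dressed composite leg acting on `b` is
the UNDRESSED composite response plus the gradient of `λ := Psi ρ Lc m k b − bmGaugeAt ρ (T^B b) Lc` (leaf-03's `legAct_legChain_respStepBm` with
`Π^ρ_bm = id − grad ∘ bmGaugeAt` unfolded). -/
theorem legAct_legChain_eq_add_dz {Lc : ℕ} [NeZero Lc] {rr : Fin (d + 1) → ℕ} (hrr : rr ∈ box (d + 1) Lc) (m k : ℕ)
    {b : Form1 (d + 1) ℝ} (hb : ∀ μ, Summable (b μ)) :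
    legAct (legChain (respStepBmSeq (d := d) (toSite rr) Lc) m k) b
      = legAct (respStep (d := d) (Lc ^ m) (Lc ^ (m + k + 1))) b
        + dz (Psi (toSite rr) Lc m k b - bmGaugeAt (toSite rr) (legAct (respStep (d := d) (Lc ^ m) (Lc ^ (m + k + 1))) b) Lc) := by
  rw [legAct_legChain_respStepBm hrr m k hb, axProjBmAt, grad_eq_dz, AffineReproduction.dz_sub]
  abel

/-! ## §2 `d = 3`: the uniform laws in units -/

section Four

variable {Lc : ℕ} [NeZero Lc]

/-- NOT IN PRINT; OUR BOOKKEEPING.  **THE ONE-LEVEL ROOTED GAUGE OF THE UNDRESSED COMPOSITE RESPONSE** (in-block root; source `j+1` levels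
above the gauge's own level `n`): `|bmGaugeAt ρ (legAct (respStep (Lc^n) (Lc^(n+j+1))) b) Lc p| ≤ K·Lc·(Lc^{5(j+1)})⁻¹·β` for ALL `n j` —
at most `2·(d+1)·Lc` letters of the response (`abs_bmGaugeAt_le_of_sup`). -/
theorem exists_abs_bmGaugeAt_respStep_le :
    ∃ K : ℝ, 0 ≤ K ∧ ∀ (rr : Fin (3 + 1) → ℕ), rr ∈ box (3 + 1) Lc →
      ∀ (n j : ℕ) (b : Form1 (3 + 1) ℝ) (β : ℝ), (∀ μ y, |b μ y| ≤ β) →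
        ∀ p : Site (3 + 1), |bmGaugeAt (toSite rr) (legAct (respStep (d := 3) (Lc ^ n) (Lc ^ (n + j + 1))) b) Lc p|
          ≤ K * (Lc : ℝ) * ((Lc : ℝ) ^ (5 * (j + 1)))⁻¹ * β := by
  obtain ⟨K, hK, h⟩ := exists_abs_legAct_respStep_le (Lc := Lc)
  refine ⟨2 * (((3 : ℕ) : ℝ) + 1) * K, by positivity, ?_⟩
  intro rr hrr n j b β hb p
  have hLc : 1 ≤ Lc := Nat.one_le_iff_ne_zero.2 (NeZero.ne Lc)
  have hg := abs_bmGaugeAt_le_of_sup (d := 3) hLc hrr (h n j b β hb) p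
  exact hg.trans (le_of_eq (by ring))

/-- NOT IN PRINT; OUR BOOKKEEPING.  **CT-2 PER LEVEL** (the refuter's (r-ii)): the `i`-th term of `Ψ_{m,k}` — the gauge of the intermediate
level `m+i+1`, `N = m+k+1` the source level with `N = (m+i+1) + j + 1` — read `i+1` levels down with the transport factor `(Lc^{4(i+1)})⁻¹`:
`|((Lc^{4(i+1)})⁻¹) · bmGaugeAt ρ (legAct (respStep (Lc^(m+i+1)) (Lc^N)) b) Lc (blk (Lc^(i+1)) x)| ≤ K·(Lc^{4(i+1)})⁻¹·(Lc·(Lc^{5(j+1)})⁻¹)·β`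
for ALL `m i j` — transport factor × gauge amplitude; in `Ψ` the terms grow geometrically (ratio `Lc`) towards the source. -/
theorem exists_abs_PsiTerm_le :
    ∃ K : ℝ, 0 ≤ K ∧ ∀ (rr : Fin (3 + 1) → ℕ), rr ∈ box (3 + 1) Lc →
      ∀ (m i j N : ℕ), N = m + i + 1 + j + 1 → ∀ (b : Form1 (3 + 1) ℝ) (β : ℝ), (∀ μ y, |b μ y| ≤ β) →
        ∀ x : Site (3 + 1),
          |((Lc : ℝ) ^ ((3 + 1) * (i + 1)))⁻¹ *
              bmGaugeAt (toSite rr) (legAct (respStep (d := 3) (Lc ^ (m + i + 1)) (Lc ^ N)) b) Lc (blk (Lc ^ (i + 1)) x)|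
            ≤ K * ((Lc : ℝ) ^ (4 * (i + 1)))⁻¹ * ((Lc : ℝ) * ((Lc : ℝ) ^ (5 * (j + 1)))⁻¹) * β := by
  obtain ⟨K, hK, h⟩ := exists_abs_bmGaugeAt_respStep_le (Lc := Lc)
  refine ⟨K, hK, ?_⟩
  intro rr hrr m i j N hN b β hb x
  subst hN
  have hL0 : (0 : ℝ) < Lc := by exact_mod_cast Nat.pos_of_ne_zero (NeZero.ne Lc)
  have hg := h rr hrr (m + i + 1) j b β hb (blk (Lc ^ (i + 1)) x)
  rw [abs_mul, abs_inv, abs_pow, abs_of_pos hL0, show (3 + 1) * (i + 1) = 4 * (i + 1) by ring]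
  calc ((Lc : ℝ) ^ (4 * (i + 1)))⁻¹ *
        |bmGaugeAt (toSite rr) (legAct (respStep (d := 3) (Lc ^ (m + i + 1)) (Lc ^ (m + i + 1 + j + 1))) b) Lc (blk (Lc ^ (i + 1)) x)|
      ≤ ((Lc : ℝ) ^ (4 * (i + 1)))⁻¹ * (K * (Lc : ℝ) * ((Lc : ℝ) ^ (5 * (j + 1)))⁻¹ * β) :=
        mul_le_mul_of_nonneg_left hg (by positivity)
    _ = _ := by ring

/-- NOT IN PRINT; OUR BOOKKEEPING.  **CT-2 SUMMED — THE ACCUMULATED INTER-BLOCK GAUGE IS BOUNDED IN UNITS, UNIFORMLY IN THE PAIR OF LEVELS**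
(`d = 3`, `2 ≤ Lc`, in-block root): ONE `K ≥ 0` with, for ALL `m k`, every datum with `|b μ y| ≤ β` and every site `x`,
`|Psi ρ Lc m k b x| ≤ K·(Lc^{4(k+1)})⁻¹·β` — the `k` per-level terms (`exists_abs_PsiTerm_le`) form a geometric series of ratio `Lc` dominated by the
COARSEST intermediate level (`Σ_{i<k} Lc^i ≤ 2·Lc^k∕Lc`), one power of `L = Lc^(k+1)` above the undressed response's `(Lc^{5(k+1)})⁻¹`
(the owner's «`|Ψ| ≤ C·N·σ_f`»). -/
theorem exists_abs_Psi_le (hLc : 2 ≤ Lc) :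
    ∃ K : ℝ, 0 ≤ K ∧ ∀ (rr : Fin (3 + 1) → ℕ), rr ∈ box (3 + 1) Lc →
      ∀ (m k : ℕ) (b : Form1 (3 + 1) ℝ) (β : ℝ), (∀ μ y, |b μ y| ≤ β) →
        ∀ x : Site (3 + 1), |Psi (toSite rr) Lc m k b x| ≤ K * ((Lc : ℝ) ^ (4 * (k + 1)))⁻¹ * β := by
  obtain ⟨K, hK, h⟩ := exists_abs_PsiTerm_le (Lc := Lc)
  refine ⟨2 * K, by positivity, ?_⟩
  intro rr hrr m k b β hb x
  have hβ : 0 ≤ β := (abs_nonneg _).trans (hb 0 0)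
  have hL : (2 : ℝ) ≤ Lc := by exact_mod_cast hLc
  have hL0 : (0 : ℝ) < Lc := by linarith
  rw [Psi_apply, abs_neg]
  have hterm : ∀ i ∈ Finset.range k,
      |((Lc : ℝ) ^ ((3 + 1) * (i + 1)))⁻¹ *
          bmGaugeAt (toSite rr) (legAct (respStep (d := 3) (Lc ^ (m + i + 1)) (Lc ^ (m + k + 1))) b) Lc (blk (Lc ^ (i + 1)) x)|
        ≤ K * β * ((Lc : ℝ) ^ (5 * k + 3))⁻¹ * (Lc : ℝ) ^ i := by
    intro i hi
    have hik : i < k := Finset.mem_range.1 hi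
    have hg := h rr hrr m i (k - i - 1) (m + k + 1) (by omega) b β hb x
    refine hg.trans (le_of_eq ?_)
    have e : (Lc : ℝ) ^ (5 * k + 3) = (Lc : ℝ) ^ (4 * (i + 1)) * (Lc : ℝ) ^ (5 * (k - i - 1 + 1)) * (Lc : ℝ) ^ i / Lc := by
      rw [eq_div_iff hL0.ne', ← pow_add, ← pow_add, ← pow_succ]
      congr 1
      omega
    rw [e]
    field_simp
  calc |∑ i ∈ Finset.range k, ((Lc : ℝ) ^ ((3 + 1) * (i + 1)))⁻¹ *
          bmGaugeAt (toSite rr) (legAct (respStep (d := 3) (Lc ^ (m + i + 1)) (Lc ^ (m + k + 1))) b) Lc (blk (Lc ^ (i + 1)) x)|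
      ≤ ∑ i ∈ Finset.range k, |((Lc : ℝ) ^ ((3 + 1) * (i + 1)))⁻¹ *
          bmGaugeAt (toSite rr) (legAct (respStep (d := 3) (Lc ^ (m + i + 1)) (Lc ^ (m + k + 1))) b) Lc (blk (Lc ^ (i + 1)) x)| :=
        Finset.abs_sum_le_sum_abs _ _
    _ ≤ ∑ i ∈ Finset.range k, K * β * ((Lc : ℝ) ^ (5 * k + 3))⁻¹ * (Lc : ℝ) ^ i := Finset.sum_le_sum hterm
    _ = K * β * ((Lc : ℝ) ^ (5 * k + 3))⁻¹ * ∑ i ∈ Finset.range k, (Lc : ℝ) ^ i := by rw [Finset.mul_sum]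
    _ ≤ K * β * ((Lc : ℝ) ^ (5 * k + 3))⁻¹ * (2 * (Lc : ℝ) ^ k / Lc) :=
        mul_le_mul_of_nonneg_left (geom_sum_le_of_two_le hL k) (by positivity)
    _ = 2 * K * ((Lc : ℝ) ^ (4 * (k + 1)))⁻¹ * β := by
        have e : (Lc : ℝ) ^ (5 * k + 3) * Lc = (Lc : ℝ) ^ (4 * (k + 1)) * (Lc : ℝ) ^ k := by
          rw [← pow_succ, ← pow_add]
          congr 1
          ring
        field_simp
        linear_combination (-(K * β)) * e

/-- NOT IN PRINT; OUR BOOKKEEPING.  **THE PURE-GAUGE PART OF THE DRESSED COMPOSITE LEG IN UNITS**: `|dz (Psi ρ Lc m k b) κ x| ≤ K·(Lc^{4(k+1)})⁻¹·β`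
for ALL `m k` (`2 ≤ Lc`; twice the bound of `exists_abs_Psi_le`, folded into `K`). -/
theorem exists_abs_dz_Psi_le (hLc : 2 ≤ Lc) :
    ∃ K : ℝ, 0 ≤ K ∧ ∀ (rr : Fin (3 + 1) → ℕ), rr ∈ box (3 + 1) Lc →
      ∀ (m k : ℕ) (b : Form1 (3 + 1) ℝ) (β : ℝ), (∀ μ y, |b μ y| ≤ β) →
        ∀ (κ : Fin (3 + 1)) (x : Site (3 + 1)), |dz (Psi (toSite rr) Lc m k b) κ x| ≤ K * ((Lc : ℝ) ^ (4 * (k + 1)))⁻¹ * β := by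
  obtain ⟨K, hK, h⟩ := exists_abs_Psi_le (Lc := Lc) hLc
  refine ⟨2 * K, by positivity, ?_⟩
  intro rr hrr m k b β hb κ x
  have hg := abs_dz_le_two_mul (h rr hrr m k b β hb) κ x
  exact hg.trans (le_of_eq (by ring))

/-- NOT IN PRINT; OUR BOOKKEEPING.  **THE OWNER's «`|λ| ≤ C·N·σ_f`» FOR THE FULL GAUGE OF THE DRESSED LEG** (`d = 3`, `2 ≤ Lc`, in-block root):
`|(Psi ρ Lc m k b − bmGaugeAt ρ (T^B b) Lc) x| ≤ K·(Lc^{4(k+1)})⁻¹·sup|b|` for ALL `m k` — CT-2 summed plus the top level's own rooted gauge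
(`K₁·Lc·(Lc^{5(k+1)})⁻¹ ≤ K₁·(Lc^{4(k+1)})⁻¹`). -/
theorem exists_abs_gauge_le (hLc : 2 ≤ Lc) :
    ∃ K : ℝ, 0 ≤ K ∧ ∀ (rr : Fin (3 + 1) → ℕ), rr ∈ box (3 + 1) Lc →
      ∀ (m k : ℕ) (b : Form1 (3 + 1) ℝ) (β : ℝ), (∀ μ y, |b μ y| ≤ β) → ∀ x : Site (3 + 1),
        |(Psi (toSite rr) Lc m k b
            - bmGaugeAt (toSite rr) (legAct (respStep (d := 3) (Lc ^ m) (Lc ^ (m + k + 1))) b) Lc) x|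
          ≤ K * ((Lc : ℝ) ^ (4 * (k + 1)))⁻¹ * β := by
  obtain ⟨K₁, hK₁, h₁⟩ := exists_abs_bmGaugeAt_respStep_le (Lc := Lc)
  obtain ⟨K₂, hK₂, h₂⟩ := exists_abs_Psi_le (Lc := Lc) hLc
  refine ⟨K₂ + K₁, by positivity, ?_⟩
  intro rr hrr m k b β hb x
  have hβ : 0 ≤ β := (abs_nonneg _).trans (hb 0 0)
  have hL1 : (1 : ℝ) ≤ Lc := by exact_mod_cast le_trans (by norm_num) hLc
  have hg := h₁ rr hrr m k b β hb x
  have hΨ := h₂ rr hrr m k b β hb x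
  have hpow : (Lc : ℝ) * ((Lc : ℝ) ^ (5 * (k + 1)))⁻¹ ≤ ((Lc : ℝ) ^ (4 * (k + 1)))⁻¹ := by
    rw [← div_eq_mul_inv, div_le_iff₀ (by positivity), inv_mul_eq_div, le_div_iff₀ (by positivity), ← pow_succ']
    exact pow_le_pow_right₀ hL1 (by omega)
  rw [Pi.sub_apply]
  calc |Psi (toSite rr) Lc m k b x - bmGaugeAt (toSite rr) (legAct (respStep (d := 3) (Lc ^ m) (Lc ^ (m + k + 1))) b) Lc x|
      ≤ K₂ * ((Lc : ℝ) ^ (4 * (k + 1)))⁻¹ * β + K₁ * (Lc : ℝ) * ((Lc : ℝ) ^ (5 * (k + 1)))⁻¹ * β :=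
        (abs_sub _ _).trans (add_le_add hΨ hg)
    _ ≤ K₂ * ((Lc : ℝ) ^ (4 * (k + 1)))⁻¹ * β + K₁ * ((Lc : ℝ) ^ (4 * (k + 1)))⁻¹ * β := by
        have := mul_le_mul_of_nonneg_left hpow hK₁
        nlinarith [mul_le_mul_of_nonneg_right this hβ]
    _ = _ := by ring

/-- NOT IN PRINT; OUR BOOKKEEPING.  **THE DRESSED COMPOSITE LEGS ARE BOUNDED IN UNITS, UNIFORMLY IN THE PAIR OF LEVELS** (`d = 3`, `2 ≤ Lc`,
in-block root `ρ = toSite rr`): ONE `K ≥ 0` with, for ALL `m k`, every componentwise summable datum with `|b μ y| ≤ β` and every fine bond `(κ, u)`,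
`|legAct (legChain (respStepBmSeq ρ Lc) m k) b κ u| ≤ K·(Lc^{4(k+1)})⁻¹·β` — leaf-03's decomposition `legAct_legChain_respStepBm`
(`T = Π^ρ_bm (undressed response) + dz Ψ`), the projector's sup form on the undressed `(Lc^{5(k+1)})⁻¹` law and CT-2 summed for the gauge part;
the dressed leg sits ONE power of `L = Lc^(k+1)` above the undressed response (its inter-block gauge sawtooth dominates). -/
theorem exists_abs_legAct_legChain_le (hLc : 2 ≤ Lc) :
    ∃ K : ℝ, 0 ≤ K ∧ ∀ (rr : Fin (3 + 1) → ℕ) (hrr : rr ∈ box (3 + 1) Lc) (m k : ℕ) (b : Form1 (3 + 1) ℝ) (β : ℝ),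
      (∀ μ, Summable (b μ)) → (∀ μ y, |b μ y| ≤ β) →
        ∀ (κ : Fin (3 + 1)) (u : Site (3 + 1)),
          |legAct (legChain (respStepBmSeq (d := 3) (toSite rr) Lc) m k) b κ u| ≤ K * ((Lc : ℝ) ^ (4 * (k + 1)))⁻¹ * β := by
  obtain ⟨K₁, hK₁, h₁⟩ := exists_abs_legAct_respStep_le (Lc := Lc)
  obtain ⟨K₂, hK₂, h₂⟩ := exists_abs_dz_Psi_le (Lc := Lc) hLc
  refine ⟨(1 + 4 * ((((3 : ℕ) : ℝ) + 1) * Lc)) * K₁ + K₂, by positivity, ?_⟩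
  intro rr hrr m k b β hsum hb κ u
  have hβ : 0 ≤ β := (abs_nonneg _).trans (hb 0 0)
  have hLc1 : 1 ≤ Lc := le_trans (by norm_num) hLc
  have hL1 : (1 : ℝ) ≤ Lc := by exact_mod_cast hLc1
  rw [legAct_legChain_respStepBm hrr m k hsum, Pi.add_apply, Pi.add_apply]
  have hproj := abs_axProjBmAt_le_of_sup (d := 3) hLc1 hrr (h₁ m k b β hb) κ u
  have hgauge := h₂ rr hrr m k b β hb κ u
  have hpow : ((Lc : ℝ) ^ (5 * (k + 1)))⁻¹ ≤ ((Lc : ℝ) ^ (4 * (k + 1)))⁻¹ :=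
    inv_anti₀ (by positivity) (pow_le_pow_right₀ hL1 (by omega))
  have hproj' : |axProjBmAt (toSite rr) Lc (legAct (respStep (d := 3) (Lc ^ m) (Lc ^ (m + k + 1))) b) κ u|
      ≤ (1 + 4 * ((((3 : ℕ) : ℝ) + 1) * Lc)) * (K₁ * ((Lc : ℝ) ^ (4 * (k + 1)))⁻¹ * β) :=
    hproj.trans (mul_le_mul_of_nonneg_left (mul_le_mul_of_nonneg_right (mul_le_mul_of_nonneg_left hpow hK₁) hβ) (by positivity))
  exact (abs_add_le _ _).trans ((add_le_add hproj' hgauge).trans (le_of_eq (by ring)))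

end Four

end Summit.QuantumFields.BalabanUV.Beta.GAN24.DressedLegUnits

end
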